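import Summits.QuantumFields.BalabanUV.Beta.D1BFx.GhostTadpoleRest

/-!
# `BalabanUV.Beta.D1BFx.GhostBubbleRest` — road «BF-x» for binder row D1, slot (REST), the `RestIdx` range `Sum.inr (Sum.inr (Sum.inr (Sum.inl x)))`:
# THE FIFTEEN GHOST BUBBLE WORDS `restK_gbub x`, `x = (i,j,r,r′) ≠ (0,0,0,0)` (sectors {KIN, Q}² × leg pieces {frozen, difference}²), BOUNDED AT
# EVERY BLOCK SIZE BY `|ω_gh|·|ghWt i|·|ghWt j|·n⁻⁸·β′₍₅.₁₀₎(4, T_bub, δ∕(4n))` IN THE EXPONENTIAL CURRENCY — the generic two-leg bubble word at a base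
# site with EXPLICIT constants (the quantitative form of `FineHessianSectors.exists_decay_biBubbleTable`), the ghost legs∕sectors with explicit
# `(constant, rate)` at one common rate `δ∕n`, and the packaged (REST) binder of `Assembly.hT_of_slots` for the range with the n-uniformity
# isolated in ONE displayed inequality (the A3-gh content — NOT proved here)

HONEST DEPENDENCY (page 1, mandatory): continuum YM on T⁴ ⇐ BetaPertH ∧ nine spine estimates (0/9 proved); BetaPertH ⇐ (D1) ∧ (D4) ∧
CAP+tail; G-an2-4 gates asym, D1 and NE2/3/4.  HONEST FRAMING (cell contract, verbatim): «discharging `BetaPertH` makes Bałaban's UV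
stability UNCONDITIONAL — a real constructive-QFT result; it is NOT the continuum limit and NOT the Clay problem.»  THIS MODULE DISCHARGES
NOTHING of the wall: it is [folklore] bookkeeping BY NAME over lit's `ExpKernelCalculus` (`biLoc_comp_decays`, `biLoc_comp_biLoc`, `abs_tr_le`, `Zl`),
`B12Sec2to5` (`Decay510`, `secondMoment_abs_le_of_decay510`, `betaPrime510`), `WindowIdentification` (`secondMoment_eq_fullSum'`, `fullSum_const_mul`,
`exists_tendsto_psum_of_summable`), `HessKerRate.decays_sub`, the road's `TameKernelCalculus.decays_of_le`, `PackedKernelSplit.biBubble`∕`decays_weaken`,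
`DressedBubbleBridge.biLoc_const_mono`, leaf A6 `ContactCount.abs_sum_mul_le_of_convex`, leaf-03-g3's `FineHessianSectors.biBubbleTable` ∕
`FineHessianLegGrades.frozenLeg`∕`decays_frozenLeg` ∕ `FineHessianGhostGrades.ghSec`∕`ghWt`∕`ghLeg`, the typer's `GhostLeg.decays_Ggh`, T6 `GhostStencil.biLoc_ghCur`,
leaf-01's `GhostStencilRooted.biLoc_qAntiAt` + `GhostStencilRootedReflection.ctrHalf_mem`, and the owner's `SplitInstance.restK_gbub` ∕ `SplitPackaged.KrPk` ∕
`Assembly.sum_uniform_resSite`.  No `def`, no `Prop` minted, nothing printed asserted, no citation, 0 sorry.  The legs `A`, `B`, the sector families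
`S`, `T`, the weights `ω_gh`, `cK`, `cQ`, the profile `g` and every constant are ARBITRARY parameters: nothing about Bałaban's operators is asserted.
0 wall binders; NOT the A3-gh bound, NOT the (K) slot, NOT D1, NOT `BetaPertH`, NOT continuum, NOT Clay.

ABSOLUTE RULE (cell charter, verbatim): «No internally-minted statement may enter as a cited fact. Every hypothesis is either kernel-proved in
this package or a verbatim quotation of a PUBLISHED theorem with page reference. The manuscript(s) under audit are NOT citable for their own
disputed steps — they are the thing under adjudication; programme-internal (2001/route/tribunal) claims are never citable.»

WHY (owner d1-p2-g2, journal l.15231 «Remaining `RestIdx` ranges (claimable, state the range): … `inr inr inr inl` ghost bubbles off (0,0,0,0)»;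
`LEAVES-BFx.md` OPEN LEAF TABLE v1.8 «REST ranges: … gbub off-diag `inr inr inr inl` … each = `|Σ_{b ∈ image resSite} n⁻⁴·fullSum (restK … τ n b)| ≤ CR τ`
with CR INDEPENDENT of n»; `SPLIT-SPEC.md` §3 «REST: `KIN × qAntiAt` (A3.a-gh), `qAntiAt × qAntiAt` (A3.b-gh), graded-leg words (A3.c-gh)»).  The ghost
bubble words are `restK_gbub (i,j,r,r′) = w ↦ ω_gh·(ghWt i·ghWt j·(n⁻⁸·(w_μw_ν·baseKer (biBubbleTable (ghLeg r) (ghLeg r′) (ghSec i) (ghSec j) μ ν) b w)))`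
(`SplitInstance.restK_gbub`; the `0000` word is `0`, its model block being MAIN-gh).  Unlike the tadpole words (`TadpoleRest`, `GhostTadpoleRest`:
finitely supported in `w`), a bubble word is supported on ALL of `ℤ⁴`: the two stencils sit at the bonds `(μ, b+w)` and `(ν, b)` and are joined by
the two legs, so the decay in `w` is the legs' decay.  In the EXPONENTIAL currency of the tree (`Decays`∕`BiLoc` with constants and rates) the
word's base-point kernel is a (5.10)-kernel `|K w| ≤ T_bub·e^{−(m∕4)|w|₁}` for the common rate `m` of legs and sectors (§1, the explicit-constant
form of `FineHessianSectors.exists_decay_biBubbleTable`), and a (5.10)-kernel has `|fullSum (w ↦ w_μw_ν·K w)| ≤ β′(4, T_bub, m∕4) = T_bub·Σ_x |x|₁² e^{−(m∕4)|x|₁}`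
(`B12Sec2to5.secondMoment_abs_le_of_decay510` + the bridge `WindowIdentification.secondMoment_eq_fullSum'`).  For the ghost data the common rate is
`δ∕n` (§2): the difference leg inherits the typer's rate `δ_u(4,a)∕(4n)` (`GhostLeg.decays_Ggh`), the Q sector `qAntiAt (ctrHalf n) n` is localised at rate
`δ∕n` with constant `(8∕n³)·e^{8δ}` (`biLoc_qAntiAt`), KIN at any rate (`biLoc_ghCur`), the frozen leg at the profile's own rate.
HONEST, UP FRONT: in this currency `T_bub n` carries four lattice constants `Zl 4 (·∕n)` and `β′` the (1.22)-moment sum at rate `δ∕(4n)` — each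
polynomially LARGE in `n` — against the one factor `n⁻⁸`; so the displayed inequality `hCR` of §4 is a TARGET SHAPE whose n-uniformity is
EXACTLY the A3-gh content (algebraic `d0`-type leg rows `GhostLegFree.ghost_d0`∕`d1`, Ward∕parity of the Q sector, the graded difference leg's
gain), ruled NOWHERE in this file and not expected to follow from the exponential constants displayed here.  What the file DOES settle: the
wiring of the range into `AssemblyEnd.defect_le_at`'s `hRest` ∕ `Assembly.hT_of_slots`'s `hR` at every fixed `n`, with every constant explicit and
every hypothesis one of: `0 < a`, an exponential profile bound, a rate choice.  (CONV) for the range is NOT restated: leaf-03-g4's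
`RestConv.conv_restK` ∕ `hKr_packaged` (p223080) covers all 116 `RestIdx` words.

CONTENT (all [folklore]; `|F|` = `Fintype.card F`; `T_bub(CA, CB, Cs, Ct, m) := ½·(|F|·(|F|·((|F|·(CA·Cs)·Zl 4 (m − m∕2))·(|F|·(CB·Ct)·Zl 4 (m − m∕2)))·Zl 4 (m∕2∕2))·Zl 4 (m∕2∕2))`,
written out, never named).
* §1 GENERIC BUBBLE WORD AT A BASE SITE over any fibre: **`decay510_baseKer_biBubbleTable`** (legs `Decays A CA m`, `Decays B CB m`; sector families
  `BiLoc (S κ u) u u Cs m`, `BiLoc (T κ u) u u Ct m`; `0 < m` ⟹ `Decay510 (baseKer (biBubbleTable A B S T κ′ λ′) b) T_bub (m∕2∕2)`, every entry, every base site),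
  **`abs_fullSum_bubbleWord_le`** (`|fullSum (w ↦ c·(w_μw_ν·baseKer (biBubbleTable A B S T μ ν) b w))| ≤ |c|·betaPrime510 4 T_bub (m∕2∕2)`), `conv_bubbleWord` ((CONV), by-product).
* §2 THE GHOST DATA WITH EXPLICIT CONSTANTS at the common rate `δ∕n` (`0 ≤ δ ≤ δ_u(4,a)∕4`, `δ∕n ≤ δg`): **`decays_ghLeg`** (both pieces, constant `2∕min 2 a + Cg`),
  **`biLoc_ghSec`** (both sectors, constant `e^{δ∕n} + (8∕n³)·e^{8δ}`).
* §3 THE FIFTEEN WORDS AT FIXED `(n, b)`: `restK_gbub_eq_const_mul`, **`abs_fullSum_restK_gbub_le`** (every `x`; the `0000` word trivially), `abs_avg_fullSum_restK_gbub_le`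
  (convex base-point average).
* §4 PACKAGED against `SplitPackaged.KrPk … (Sum.inr (Sum.inr (Sum.inr (Sum.inl x))))`: **`hR_gbub_packaged`** — the (REST) binder for the range, ∀ `n ≥ 2`, from `0 < a`, the
  exponential profile bound `|gp n b v| ≤ Cg n·e^{−δg n·|v|₁}`, a rate `δ n` (`0 < δ n ≤ δ_u(4,a)∕4`, `δ n∕n ≤ δg n`) and the DISPLAYED weight inequality `hCR`.
Unit `b2b-balaban-gan24-formalise-leaf-05` (gen 32; cross-lane idle G-an2-4 leaf seat), `LEAVES-BFx.md` row (REST) ∕ A3-gh (sub-leaf «D1-BFx-REST-gbub»).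
-/

noncomputable section

namespace Summit.QuantumFields.BalabanUV.Beta.D1BFx.GhostBubbleRest

open Finset Filter Topology
open scoped BigOperators
open Literature.MathematicalPhysics.QuantumFieldTheory.Balaban1983to89
open Literature.MathematicalPhysics.QuantumFieldTheory.Balaban1983to89.Beta
open B12Sec2to5 (l1 l1_nonneg Decay510 betaPrime510 secondMoment_abs_le_of_decay510)
open B6QGQDecay237 (deltaU deltaU_pos)
open ExpKernelCalculus (Site MKer Decays BiLoc comp tr Zl Zl_nonneg biLoc_comp_decays biLoc_comp_biLoc abs_tr_le)
open HessKerRate (decays_sub)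
open WindowIdentification (psum fullSum fullSum_const_mul exists_tendsto_psum_of_summable secondMoment_eq_fullSum')
open DyadicShell (Pt toReal)
open DressedMomentNormalisation (resSite)
open Summit.QuantumFields.BalabanUV.Beta.TameKernelCalculus (decays_of_le)
open Summit.QuantumFields.BalabanUV.Beta.D1BFx.PackedKernelSplit (biBubble decays_weaken)
open Summit.QuantumFields.BalabanUV.Beta.D1BFx.DressedBubbleBridge (biLoc_const_mono)
open Summit.QuantumFields.BalabanUV.Beta.D1BFx.MomentTransferPeriodic (baseKer)
open Summit.QuantumFields.BalabanUV.Beta.D1BFx.ReducedKernel (TableR)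
open Summit.QuantumFields.BalabanUV.Beta.D1BFx.ContactCount (abs_sum_mul_le_of_convex)
open Summit.QuantumFields.BalabanUV.Beta.D1BFx.Assembly (sum_uniform_resSite uniform_resSite_nonneg exists_tendsto_psum_const_mul)
open Summit.QuantumFields.BalabanUV.Beta.D1BFx.GhostLeg (Ggh decays_Ggh)
open Summit.QuantumFields.BalabanUV.Beta.D1BFx.GhostStencil (ghCur biLoc_ghCur)
open Summit.QuantumFields.BalabanUV.Beta.D1BFx.GhostStencilRooted (qAntiAt biLoc_qAntiAt)
open Summit.QuantumFields.BalabanUV.Beta.D1BFx.GhostStencilRootedReflection (ctrHalf ctrHalf_mem)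
open Summit.QuantumFields.BalabanUV.Beta.D1BFx.FineHessianSectors (biBubbleTable biBubbleTable_apply)
open Summit.QuantumFields.BalabanUV.Beta.D1BFx.FineHessianLegGrades (frozenLeg decays_frozenLeg)
open Summit.QuantumFields.BalabanUV.Beta.D1BFx.FineHessianGhostGrades (ghSec ghWt ghLeg ghSec_zero ghSec_one ghLeg_zero ghLeg_one)
open Summit.QuantumFields.BalabanUV.Beta.D1BFx.SplitInstance (RestIdx restK restK_gbub)
open Summit.QuantumFields.BalabanUV.Beta.D1BFx.SplitPackaged (KrPk)

/-! ## §1 The generic two-leg bubble word at a base site: explicit (5.10)-decay, weighted full sum, (CONV) -/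

section Generic

variable {F : Type*} [Fintype F] {A B : MKer 4 F} {S T : Fin 4 → Site 4 → MKer 4 F} {CA CB Cs Ct m : ℝ}

/-- [folklore] **THE BASE-POINT KERNEL OF A TWO-LEG BUBBLE WORD IS A (5.10)-KERNEL WITH EXPLICIT CONSTANT** (the quantitative form of
`FineHessianSectors.exists_decay_biBubbleTable`): legs `A`, `B` decaying at the common rate `m > 0` with constants `CA`, `CB`, sector families `S`, `T`
bi-localised at their bond's site at rate `m` with constants `Cs`, `Ct` ⟹ for every entry `(κ′, λ′)` and every base site `b`,
`|baseKer (biBubbleTable A B S T κ′ λ′) b t| ≤ T_bub·e^{−(m∕2∕2)|t|₁}`, `T_bub = ½·|F|·(|F|·C₁·C₂·Zl 4 (m∕2∕2))·Zl 4 (m∕2∕2)`,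
`C₁ = |F|·CA·Cs·Zl 4 (m − m∕2)`, `C₂ = |F|·CB·Ct·Zl 4 (m − m∕2)` (`biLoc_comp_decays` twice, `biLoc_comp_biLoc`, `abs_tr_le`). -/
theorem decay510_baseKer_biBubbleTable (hA : Decays A CA m) (hB : Decays B CB m) (hS : ∀ κ u, BiLoc (S κ u) u u Cs m)
    (hT : ∀ κ u, BiLoc (T κ u) u u Ct m) (hm : 0 < m) (κ' l' : Fin 4) (b : Site 4) :
    Decay510 (baseKer (biBubbleTable A B S T κ' l') b)
      ((1 / 2 : ℝ) * ((Fintype.card F : ℝ) * ((Fintype.card F : ℝ) *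
        (((Fintype.card F : ℝ) * (CA * Cs) * Zl 4 (m - m / 2)) * ((Fintype.card F : ℝ) * (CB * Ct) * Zl 4 (m - m / 2))) *
          Zl 4 (m / 2 / 2)) * Zl 4 (m / 2 / 2))) (m / 2 / 2) := by
  intro t
  rcases isEmpty_or_nonempty F with hF | ⟨⟨f⟩⟩
  · have h0 : baseKer (biBubbleTable A B S T κ' l') b t = 0 := by
      simp [baseKer, biBubbleTable_apply, biBubble, ExpKernelCalculus.tr, Finset.univ_eq_empty]
    simp only [h0, abs_zero, Fintype.card_eq_zero, Nat.cast_zero, zero_mul, mul_zero, le_refl]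
  have hCA := hA.nonneg f
  have hCB := hB.nonneg f
  have hCs := (hS κ' b).nonneg f
  have hCt := (hT l' b).nonneg f
  have hZ1 : 0 ≤ Zl 4 (m - m / 2) := Zl_nonneg (by linarith)
  have hZ2 : 0 ≤ Zl 4 (m / 2 / 2) := Zl_nonneg (by linarith)
  have h1 : BiLoc (comp A (S κ' (b + t))) (b + t) (b + t) ((Fintype.card F : ℝ) * (CA * Cs) * Zl 4 (m - m / 2)) (m / 2) :=
    biLoc_comp_decays hA (hS κ' (b + t)) (by linarith) (by linarith)
  have h2 : BiLoc (comp B (T l' b)) b b ((Fintype.card F : ℝ) * (CB * Ct) * Zl 4 (m - m / 2)) (m / 2) :=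
    biLoc_comp_decays hB (hT l' b) (by linarith) (by linarith)
  have h3 := biLoc_comp_biLoc h1 h2 (half_pos hm)
  have h4 := abs_tr_le h3 (half_pos hm)
  rw [add_sub_cancel_left] at h4
  set E := Real.exp (-(m / 2 / 2) * l1 t) with hE
  have hE0 : 0 ≤ E := (Real.exp_pos _).le
  have hE1 : E ≤ 1 := by
    rw [hE, Real.exp_le_one_iff]
    nlinarith [l1_nonneg t]
  have hTb : 0 ≤ (1 / 2 : ℝ) * ((Fintype.card F : ℝ) * ((Fintype.card F : ℝ) *
      (((Fintype.card F : ℝ) * (CA * Cs) * Zl 4 (m - m / 2)) * ((Fintype.card F : ℝ) * (CB * Ct) * Zl 4 (m - m / 2))) *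
        Zl 4 (m / 2 / 2)) * Zl 4 (m / 2 / 2)) := by positivity
  simp only [baseKer, biBubbleTable_apply, biBubble, abs_mul]
  rw [show |(-(1 / 2 : ℝ))| = 1 / 2 by norm_num]
  calc (1 / 2 : ℝ) * |tr (comp (comp A (S κ' (b + t))) (comp B (T l' b)))|
      ≤ (1 / 2 : ℝ) * ((Fintype.card F : ℝ) * ((Fintype.card F : ℝ) *
          (((Fintype.card F : ℝ) * (CA * Cs) * Zl 4 (m - m / 2)) * ((Fintype.card F : ℝ) * (CB * Ct) * Zl 4 (m - m / 2))) *
            Zl 4 (m / 2 / 2) * E) * Zl 4 (m / 2 / 2) * E) := mul_le_mul_of_nonneg_left h4 (by norm_num)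
    _ = (1 / 2 : ℝ) * ((Fintype.card F : ℝ) * ((Fintype.card F : ℝ) *
          (((Fintype.card F : ℝ) * (CA * Cs) * Zl 4 (m - m / 2)) * ((Fintype.card F : ℝ) * (CB * Ct) * Zl 4 (m - m / 2))) *
            Zl 4 (m / 2 / 2)) * Zl 4 (m / 2 / 2)) * (E * E) := by ring
    _ ≤ (1 / 2 : ℝ) * ((Fintype.card F : ℝ) * ((Fintype.card F : ℝ) *
          (((Fintype.card F : ℝ) * (CA * Cs) * Zl 4 (m - m / 2)) * ((Fintype.card F : ℝ) * (CB * Ct) * Zl 4 (m - m / 2))) *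
            Zl 4 (m / 2 / 2)) * Zl 4 (m / 2 / 2)) * E :=
        mul_le_mul_of_nonneg_left (by nlinarith) hTb

/-- [folklore] **THE GENERIC BUBBLE WORD HAS A WEIGHTED FULL SUM BOUNDED BY `β′₍₅.₁₀₎`** (with a scalar prefactor `c`): under the hypotheses of
`decay510_baseKer_biBubbleTable`, `|fullSum (w ↦ c·(w_μw_ν·baseKer (biBubbleTable A B S T μ ν) b w))| ≤ |c|·betaPrime510 4 T_bub (m∕2∕2)` for every base site `b`
(`B12Sec2to5.secondMoment_abs_le_of_decay510`: dominated summation of the (1.22)-weighted kernel against `|x|₁² e^{−(m∕4)|x|₁}`; the punctured full sum IS that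
`tsum`, `WindowIdentification.secondMoment_eq_fullSum'`). -/
theorem abs_fullSum_bubbleWord_le (hA : Decays A CA m) (hB : Decays B CB m) (hS : ∀ κ u, BiLoc (S κ u) u u Cs m)
    (hT : ∀ κ u, BiLoc (T κ u) u u Ct m) (hm : 0 < m) (c : ℝ) (μ ν : Fin 4) (b : Pt) :
    |fullSum (fun w : Pt => c * (toReal w μ * toReal w ν * baseKer (biBubbleTable A B S T μ ν) b w))| ≤
      |c| * betaPrime510 4 ((1 / 2 : ℝ) * ((Fintype.card F : ℝ) * ((Fintype.card F : ℝ) *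
        (((Fintype.card F : ℝ) * (CA * Cs) * Zl 4 (m - m / 2)) * ((Fintype.card F : ℝ) * (CB * Ct) * Zl 4 (m - m / 2))) *
          Zl 4 (m / 2 / 2)) * Zl 4 (m / 2 / 2))) (m / 2 / 2) := by
  have hdec := decay510_baseKer_biBubbleTable hA hB hS hT hm μ ν b
  have hm4 : 0 < m / 2 / 2 := by positivity
  obtain ⟨hsum, hle⟩ := secondMoment_abs_le_of_decay510 (P := fun _ _ => baseKer (biBubbleTable A B S T μ ν) b) (μ := μ) (ν := ν) hm4 hdec
  have hsum' : Summable (fun w : Pt => toReal w μ * toReal w ν * baseKer (biBubbleTable A B S T μ ν) b w) :=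
    hsum.congr fun w => by simp only [toReal]; ring
  rw [fullSum_const_mul c (exists_tendsto_psum_of_summable _ hsum'), abs_mul]
  refine mul_le_mul_of_nonneg_left ?_ (abs_nonneg c)
  have e := secondMoment_eq_fullSum' (fun _ _ => baseKer (biBubbleTable A B S T μ ν) b) μ ν hsum
  rw [← e]
  unfold betaPrime510
  exact hle

/-- [folklore] **(CONV) FOR THE GENERIC BUBBLE WORD** (by-product; the road's (CONV) slot is `RestConv`'s): the punctured partial sums converge. -/
theorem conv_bubbleWord (hA : Decays A CA m) (hB : Decays B CB m) (hS : ∀ κ u, BiLoc (S κ u) u u Cs m)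
    (hT : ∀ κ u, BiLoc (T κ u) u u Ct m) (hm : 0 < m) (c : ℝ) (μ ν : Fin 4) (b : Pt) :
    ∃ L, Tendsto (psum (fun w : Pt => c * (toReal w μ * toReal w ν * baseKer (biBubbleTable A B S T μ ν) b w))) atTop (𝓝 L) := by
  have hdec := decay510_baseKer_biBubbleTable hA hB hS hT hm μ ν b
  have hm4 : 0 < m / 2 / 2 := by positivity
  obtain ⟨hsum, -⟩ := secondMoment_abs_le_of_decay510 (P := fun _ _ => baseKer (biBubbleTable A B S T μ ν) b) (μ := μ) (ν := ν) hm4 hdec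
  have hsum' : Summable (fun w : Pt => toReal w μ * toReal w ν * baseKer (biBubbleTable A B S T μ ν) b w) :=
    hsum.congr fun w => by simp only [toReal]; ring
  exact exists_tendsto_psum_const_mul c (exists_tendsto_psum_of_summable _ hsum')

end Generic

/-! ## §2 The ghost legs and sectors with explicit constants at the common rate `δ∕n` -/

section GhostData

variable (n : ℕ) [NeZero n] {a : ℝ} {g : Site 4 → ℝ} {Cg δg δ : ℝ}

/-- [folklore] **BOTH GHOST LEG PIECES DECAY AT THE COMMON RATE `δ∕n` WITH CONSTANT `2∕min 2 a + Cg`**, whenever `0 < a`, the profile obeys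
`|g v| ≤ Cg·e^{−δg|v|₁}`, `δ ≤ δ_u(4,a)∕4` and `δ∕n ≤ δg`: piece `0` is `frozenLeg g` (`decays_frozenLeg`, rate lowered to `δ∕n`), piece `1` is
`Ggh n a − frozenLeg g` (the typer's `GhostLeg.decays_Ggh` at rate `δ_u(4,a)∕(4n) ≥ δ∕n`, constant `2∕min 2 a`, FREE OF `n`; `HessKerRate.decays_sub`). -/
theorem decays_ghLeg (ha : 0 < a) (hg : ∀ v, |g v| ≤ Cg * Real.exp (-δg * l1 v)) (hδa : δ ≤ deltaU 4 a / 4) (hδg : δ / n ≤ δg)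
    (r : Fin 2) : Decays (ghLeg n a g r) (2 / min 2 a + Cg) (δ / n) := by
  have hn : (0 : ℝ) < n := by exact_mod_cast Nat.pos_of_ne_zero (NeZero.ne n)
  have hCg : 0 ≤ Cg := by
    have h := hg 0
    simp only [l1, Pi.zero_apply, Int.cast_zero, abs_zero, Finset.sum_const_zero, mul_zero, Real.exp_zero, mul_one] at h
    exact (abs_nonneg _).trans h
  have hG0 : 0 ≤ 2 / min 2 a := by positivity
  have hrate : δ / n ≤ deltaU 4 a / (4 * n) := by
    rw [← div_div]
    exact div_le_div_of_nonneg_right hδa hn.le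
  have hF0 : Decays (frozenLeg g : MKer 4 Unit) Cg (δ / n) :=
    decays_weaken (decays_frozenLeg hg) (le_of_eq (abs_of_nonneg hCg)) hδg
  have h0 : Decays (ghLeg n a g 0) (2 / min 2 a + Cg) (δ / n) := by
    rw [ghLeg_zero]
    exact decays_weaken hF0 (by rw [abs_of_nonneg hCg]; linarith) le_rfl
  have h1 : Decays (ghLeg n a g 1) (2 / min 2 a + Cg) (δ / n) := by
    rw [ghLeg_one]
    have h := decays_sub (decays_of_le (decays_Ggh n a ha) hrate) hF0
    rwa [abs_of_nonneg hG0] at h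
  fin_cases r
  · exact h0
  · exact h1

/-- [folklore] **BOTH GHOST SECTORS ARE BI-LOCALISED AT THEIR BOND'S SITE AT THE COMMON RATE `δ∕n` WITH CONSTANT `e^{δ∕n} + (8∕n³)·e^{8δ}`** (`0 ≤ δ`):
KIN `ghCur` at any rate with constant `e^{rate}` (T6 `biLoc_ghCur`), Q `qAntiAt (ctrHalf n) n` at rate `δ∕n` with constant `(8∕n³)·e^{8δ}` (leaf-01's
`biLoc_qAntiAt` at the in-block root `ctrHalf_mem`); one constant for both by monotonicity. -/
theorem biLoc_ghSec (hδ0 : 0 ≤ δ) (i : Fin 2) (κ : Fin 4) (u : Site 4) :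
    BiLoc (ghSec n i κ u) u u (Real.exp (δ / n) + 8 / (n : ℝ) ^ 3 * Real.exp (8 * δ)) (δ / n) := by
  have hA : 0 ≤ Real.exp (δ / n) := (Real.exp_pos _).le
  have hB : 0 ≤ 8 / (n : ℝ) ^ 3 * Real.exp (8 * δ) := by positivity
  have h0 : BiLoc (ghSec n 0 κ u) u u (Real.exp (δ / n) + 8 / (n : ℝ) ^ 3 * Real.exp (8 * δ)) (δ / n) := by
    rw [ghSec_zero]
    exact biLoc_const_mono (biLoc_ghCur κ u (δ / n)) (by linarith)
  have h1 : BiLoc (ghSec n 1 κ u) u u (Real.exp (δ / n) + 8 / (n : ℝ) ^ 3 * Real.exp (8 * δ)) (δ / n) := by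
    rw [ghSec_one]
    exact biLoc_const_mono (biLoc_qAntiAt n κ u (ctrHalf_mem n) hδ0) (by linarith)
  fin_cases i
  · exact h0
  · exact h1

end GhostData

/-! ## §3 The fifteen ghost bubble words at a fixed block size and base site -/

section Words

variable (n : ℕ) [NeZero n] (a : ℝ) (g : Pt → ℝ) (cE cΛ cR cK cQ cE₂ cJ4 cΛ₂ cR₂ cQ₂ x₀ : ℝ) (WE WJ WΛ WR WQ : TableR)
  (ωgl ωgh lam N : ℝ) (μ ν : Fin 4) (b : Pt)

/-- [folklore] The ghost bubble word `x = (i,j,r,r′)` as ONE scalar times §1's generic word (the `0000` word has scalar `0`):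
`restK … (Sum.inr (Sum.inr (Sum.inr (Sum.inl x)))) = w ↦ (ω_gh·[x ≠ 0]·ghWt i·ghWt j·n⁻⁸)·(w_μw_ν·baseKer (biBubbleTable (ghLeg r) (ghLeg r′) (ghSec i) (ghSec j) μ ν) b w)`. -/
theorem restK_gbub_eq_const_mul (x : Fin 2 × Fin 2 × Fin 2 × Fin 2) :
    restK n a g cE cΛ cR cK cQ cE₂ cJ4 cΛ₂ cR₂ cQ₂ x₀ WE WJ WΛ WR WQ ωgl ωgh lam N μ ν b (Sum.inr (Sum.inr (Sum.inr (Sum.inl x)))) =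
      fun w : Pt => (ωgh * (if x = ((0 : Fin 2), (0 : Fin 2), (0 : Fin 2), (0 : Fin 2)) then 0 else ghWt cK cQ x.1 * ghWt cK cQ x.2.1) *
          ((n : ℝ) ^ 8)⁻¹) *
        (toReal w μ * toReal w ν *
          baseKer (biBubbleTable (ghLeg n a g x.2.2.1) (ghLeg n a g x.2.2.2) (ghSec n x.1) (ghSec n x.2.1) μ ν) b w) := by
  funext w
  rw [restK_gbub]
  split_ifs <;> ring

variable {g} {Cg δg δ : ℝ}

/-- [folklore] **THE GHOST BUBBLE WORD `x = (i,j,r,r′)` AT FIXED `(n, b)`** (`0 < a`; profile `|g v| ≤ Cg·e^{−δg|v|₁}`; a rate `δ` with `0 < δ ≤ δ_u(4,a)∕4`,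
`δ∕n ≤ δg`): `|fullSum (restK … gbub x)| ≤ |ω_gh|·|ghWt i|·|ghWt j|·n⁻⁸·betaPrime510 4 T_bub (δ∕n∕2∕2)` with
`T_bub = ½·(1·(1·((1·(CL·Cs)·Zl 4 (δ∕n − δ∕n∕2))·(1·(CL·Cs)·Zl 4 (δ∕n − δ∕n∕2)))·Zl 4 (δ∕n∕2∕2))·Zl 4 (δ∕n∕2∕2))`, `CL = 2∕min 2 a + Cg`,
`Cs = e^{δ∕n} + (8∕n³)·e^{8δ}` (`|Unit| = 1`) — every `x`, the `0000` word (the zero function) included. -/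
theorem abs_fullSum_restK_gbub_le (x : Fin 2 × Fin 2 × Fin 2 × Fin 2) (ha : 0 < a) (hg : ∀ v, |g v| ≤ Cg * Real.exp (-δg * l1 v))
    (hδ : 0 < δ) (hδa : δ ≤ deltaU 4 a / 4) (hδg : δ / n ≤ δg) :
    |fullSum (restK n a g cE cΛ cR cK cQ cE₂ cJ4 cΛ₂ cR₂ cQ₂ x₀ WE WJ WΛ WR WQ ωgl ωgh lam N μ ν b (Sum.inr (Sum.inr (Sum.inr (Sum.inl x)))))| ≤
      |ωgh| * |ghWt cK cQ x.1| * |ghWt cK cQ x.2.1| * ((n : ℝ) ^ 8)⁻¹ *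
        betaPrime510 4 ((1 / 2 : ℝ) * ((1 : ℝ) * ((1 : ℝ) *
          (((1 : ℝ) * ((2 / min 2 a + Cg) * (Real.exp (δ / n) + 8 / (n : ℝ) ^ 3 * Real.exp (8 * δ))) * Zl 4 (δ / n - δ / n / 2)) *
            ((1 : ℝ) * ((2 / min 2 a + Cg) * (Real.exp (δ / n) + 8 / (n : ℝ) ^ 3 * Real.exp (8 * δ))) * Zl 4 (δ / n - δ / n / 2))) *
          Zl 4 (δ / n / 2 / 2)) * Zl 4 (δ / n / 2 / 2))) (δ / n / 2 / 2) := by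
  have hn : (0 : ℝ) < n := by exact_mod_cast Nat.pos_of_ne_zero (NeZero.ne n)
  have hm : 0 < δ / n := div_pos hδ hn
  have hCg : 0 ≤ Cg := by
    have h := hg 0
    simp only [l1, Pi.zero_apply, Int.cast_zero, abs_zero, Finset.sum_const_zero, mul_zero, Real.exp_zero, mul_one] at h
    exact (abs_nonneg _).trans h
  have hL := decays_ghLeg n ha hg hδa hδg
  have hSec := biLoc_ghSec n hδ.le
  have h := abs_fullSum_bubbleWord_le (F := Unit) (hL x.2.2.1) (hL x.2.2.2) (fun κ u => hSec x.1 κ u) (fun κ u => hSec x.2.1 κ u) hm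
    (ωgh * (if x = ((0 : Fin 2), (0 : Fin 2), (0 : Fin 2), (0 : Fin 2)) then 0 else ghWt cK cQ x.1 * ghWt cK cQ x.2.1) *
      ((n : ℝ) ^ 8)⁻¹) μ ν b
  rw [restK_gbub_eq_const_mul]
  simp only [Fintype.card_unit, Nat.cast_one] at h
  refine h.trans ?_
  have hZ1 : 0 ≤ Zl 4 (δ / n - δ / n / 2) := Zl_nonneg (by linarith)
  have hZ2 : 0 ≤ Zl 4 (δ / n / 2 / 2) := Zl_nonneg (by positivity)
  have hβ : 0 ≤ betaPrime510 4 ((1 / 2 : ℝ) * ((1 : ℝ) * ((1 : ℝ) *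
      (((1 : ℝ) * ((2 / min 2 a + Cg) * (Real.exp (δ / n) + 8 / (n : ℝ) ^ 3 * Real.exp (8 * δ))) * Zl 4 (δ / n - δ / n / 2)) *
        ((1 : ℝ) * ((2 / min 2 a + Cg) * (Real.exp (δ / n) + 8 / (n : ℝ) ^ 3 * Real.exp (8 * δ))) * Zl 4 (δ / n - δ / n / 2))) *
      Zl 4 (δ / n / 2 / 2)) * Zl 4 (δ / n / 2 / 2))) (δ / n / 2 / 2) := by
    unfold betaPrime510
    exact mul_nonneg (by positivity) (tsum_nonneg fun _ => mul_nonneg (sq_nonneg _) (Real.exp_pos _).le)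
  refine mul_le_mul_of_nonneg_right ?_ hβ
  have key : |(if x = ((0 : Fin 2), (0 : Fin 2), (0 : Fin 2), (0 : Fin 2)) then 0 else ghWt cK cQ x.1 * ghWt cK cQ x.2.1)| ≤
      |ghWt cK cQ x.1| * |ghWt cK cQ x.2.1| := by
    split_ifs
    · rw [abs_zero]; positivity
    · rw [abs_mul]
  rw [abs_mul, abs_mul, abs_of_nonneg (by positivity : (0 : ℝ) ≤ ((n : ℝ) ^ 8)⁻¹)]
  calc |ωgh| * |(if x = ((0 : Fin 2), (0 : Fin 2), (0 : Fin 2), (0 : Fin 2)) then 0 else ghWt cK cQ x.1 * ghWt cK cQ x.2.1)| *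
        ((n : ℝ) ^ 8)⁻¹ ≤ |ωgh| * (|ghWt cK cQ x.1| * |ghWt cK cQ x.2.1|) * ((n : ℝ) ^ 8)⁻¹ := by gcongr
    _ = |ωgh| * |ghWt cK cQ x.1| * |ghWt cK cQ x.2.1| * ((n : ℝ) ^ 8)⁻¹ := by ring

/-- [folklore] **BASE-POINT AVERAGE AT FIXED `n`** (uniform weights `n⁻⁴` on the residue sites are convex: `Assembly.sum_uniform_resSite`; the profile may
depend on the base site, `gb b`, with ONE pair `(Cg, δg)` for all base sites): under the hypotheses of `abs_fullSum_restK_gbub_le` at every base site,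
`|Σ_{b ∈ image resSite} n⁻⁴ · fullSum (restK … (gb b) … b (gbub x))| ≤` the same constant. -/
theorem abs_avg_fullSum_restK_gbub_le {gb : Pt → Pt → ℝ} (x : Fin 2 × Fin 2 × Fin 2 × Fin 2) (ha : 0 < a)
    (hg : ∀ b v, |gb b v| ≤ Cg * Real.exp (-δg * l1 v)) (hδ : 0 < δ) (hδa : δ ≤ deltaU 4 a / 4) (hδg : δ / n ≤ δg) :
    |∑ b ∈ (univ : Finset (Fin 4 → Fin n)).image resSite, ((n : ℝ) ^ 4)⁻¹ *
        fullSum (restK n a (gb b) cE cΛ cR cK cQ cE₂ cJ4 cΛ₂ cR₂ cQ₂ x₀ WE WJ WΛ WR WQ ωgl ωgh lam N μ ν b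
          (Sum.inr (Sum.inr (Sum.inr (Sum.inl x)))))| ≤
      |ωgh| * |ghWt cK cQ x.1| * |ghWt cK cQ x.2.1| * ((n : ℝ) ^ 8)⁻¹ *
        betaPrime510 4 ((1 / 2 : ℝ) * ((1 : ℝ) * ((1 : ℝ) *
          (((1 : ℝ) * ((2 / min 2 a + Cg) * (Real.exp (δ / n) + 8 / (n : ℝ) ^ 3 * Real.exp (8 * δ))) * Zl 4 (δ / n - δ / n / 2)) *
            ((1 : ℝ) * ((2 / min 2 a + Cg) * (Real.exp (δ / n) + 8 / (n : ℝ) ^ 3 * Real.exp (8 * δ))) * Zl 4 (δ / n - δ / n / 2))) *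
          Zl 4 (δ / n / 2 / 2)) * Zl 4 (δ / n / 2 / 2))) (δ / n / 2 / 2) :=
  abs_sum_mul_le_of_convex _ (fun b hb => uniform_resSite_nonneg n b hb) (sum_uniform_resSite (NeZero.ne n))
    fun b _ => abs_fullSum_restK_gbub_le n a cE cΛ cR cK cQ cE₂ cJ4 cΛ₂ cR₂ cQ₂ x₀ WE WJ WΛ WR WQ ωgl ωgh lam N μ ν b x ha (hg b) hδ hδa hδg

end Words

/-! ## §4 The packaged (REST) binder for the range `Sum.inr (Sum.inr (Sum.inr (Sum.inl ·)))` -/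

section Packaged

variable {a : ℝ} {gp : ℕ → Pt → Pt → ℝ} {cE cΛ cR cK cQ cE₂ cJ4 cΛ₂ cR₂ cQ₂ x₀ : ℕ → ℝ} {WE WJ WΛ WR WQ : ℕ → TableR}
  {ωgl ωgh lam : ℕ → ℝ} {N : ℝ} {μ ν : Fin 4} {Cg δg δ : ℕ → ℝ} {CR : ℝ}

/-- [folklore] **THE (REST) BINDER `hR` OF `Assembly.hT_of_slots` ∕ `AssemblyEnd.defect_le_at`'s `hRest` FOR THE GHOST BUBBLE RANGE**, against the owner's
packaging `SplitPackaged.KrPk` (`Bset n = image resSite`, `wt n b = n⁻⁴`).  Inputs, for every block size `n ≥ 2`: `0 < a`; an EXPONENTIAL profile bound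
`|gp n b v| ≤ Cg n·e^{−δg n·|v|₁}` (every base site); a rate `δ n` with `0 < δ n ≤ δ_u(4,a)∕4` and `δ n∕n ≤ δg n`; and the DISPLAYED WEIGHT INEQUALITY `hCR`
on `|ω_gh n|·|ghWt i|·|ghWt j|·n⁻⁸·betaPrime510 4 (T_bub n) (δ n∕n∕2∕2)` — leg constant `2∕min 2 a + Cg n`, sector constant `e^{δ n∕n} + (8∕n³)·e^{8δ n}`, four
lattice constants `Zl 4 (·)` at rates `δ n∕(2n)`, `δ n∕(4n)`, and the (1.22)-moment sum at rate `δ n∕(4n)`: POLYNOMIALLY LARGE in `n` in this currency; its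
uniformity in `n` is the A3-gh content (SPLIT-SPEC §3; slot (K) ∕ CHECK-N0's units for the weights), NOT proved here — a target shape, honestly displayed.
Output: `∀ n ≥ 2, |Σ_{b ∈ image resSite} n⁻⁴ · fullSum (KrPk … (Sum.inr (Sum.inr (Sum.inr (Sum.inl x)))) n b)| ≤ CR`. -/
theorem hR_gbub_packaged (x : Fin 2 × Fin 2 × Fin 2 × Fin 2) (ha : 0 < a)
    (hgp : ∀ n : ℕ, 2 ≤ n → ∀ b v, |gp n b v| ≤ Cg n * Real.exp (-δg n * l1 v))
    (hδ : ∀ n, 0 < δ n) (hδa : ∀ n, δ n ≤ deltaU 4 a / 4) (hδg : ∀ n : ℕ, 2 ≤ n → δ n / n ≤ δg n)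
    (hCR : ∀ n : ℕ, 2 ≤ n → |ωgh n| * |ghWt (cK n) (cQ n) x.1| * |ghWt (cK n) (cQ n) x.2.1| * ((n : ℝ) ^ 8)⁻¹ *
        betaPrime510 4 ((1 / 2 : ℝ) * ((1 : ℝ) * ((1 : ℝ) *
          (((1 : ℝ) * ((2 / min 2 a + Cg n) * (Real.exp (δ n / n) + 8 / (n : ℝ) ^ 3 * Real.exp (8 * δ n))) * Zl 4 (δ n / n - δ n / n / 2)) *
            ((1 : ℝ) * ((2 / min 2 a + Cg n) * (Real.exp (δ n / n) + 8 / (n : ℝ) ^ 3 * Real.exp (8 * δ n))) * Zl 4 (δ n / n - δ n / n / 2))) *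
          Zl 4 (δ n / n / 2 / 2)) * Zl 4 (δ n / n / 2 / 2))) (δ n / n / 2 / 2) ≤ CR) :
    ∀ n : ℕ, 2 ≤ n → |∑ b ∈ (univ : Finset (Fin 4 → Fin n)).image resSite, ((n : ℝ) ^ 4)⁻¹ *
        fullSum (KrPk a gp cE cΛ cR cK cQ cE₂ cJ4 cΛ₂ cR₂ cQ₂ x₀ WE WJ WΛ WR WQ ωgl ωgh lam N μ ν (Sum.inr (Sum.inr (Sum.inr (Sum.inl x)))) n b)|
      ≤ CR := by
  intro n hn
  have h1 : 1 ≤ n := le_trans one_le_two hn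
  haveI : NeZero n := ⟨Nat.one_le_iff_ne_zero.mp h1⟩
  have e : ∀ b, KrPk a gp cE cΛ cR cK cQ cE₂ cJ4 cΛ₂ cR₂ cQ₂ x₀ WE WJ WΛ WR WQ ωgl ωgh lam N μ ν (Sum.inr (Sum.inr (Sum.inr (Sum.inl x)))) n b =
      restK n a (gp n b) (cE n) (cΛ n) (cR n) (cK n) (cQ n) (cE₂ n) (cJ4 n) (cΛ₂ n) (cR₂ n) (cQ₂ n) (x₀ n) (WE n) (WJ n) (WΛ n) (WR n) (WQ n)
        (ωgl n) (ωgh n) (lam n) N μ ν b (Sum.inr (Sum.inr (Sum.inr (Sum.inl x)))) := by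
    intro b; funext w; simp only [KrPk, dif_pos h1]
  simp only [e]
  exact (abs_avg_fullSum_restK_gbub_le n a (cE n) (cΛ n) (cR n) (cK n) (cQ n) (cE₂ n) (cJ4 n) (cΛ₂ n) (cR₂ n) (cQ₂ n) (x₀ n) (WE n) (WJ n)
    (WΛ n) (WR n) (WQ n) (ωgl n) (ωgh n) (lam n) N μ ν x ha (hgp n hn) (hδ n) (hδa n) (hδg n hn)).trans (hCR n hn)

end Packaged

end Summit.QuantumFields.BalabanUV.Beta.D1BFx.GhostBubbleRest

end
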